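import Summits.Ventures.PercRepro.S2CubeMultiplicity

/-!
# PercRepro — S2: THE MULTIPLICITY THROUGH THE INDEPENDENT SUBSETS OF THE EXTRAS (THEOREM M)
(p4, gen 17; paper proofs/P4-gen17.md §5; announced INBOX 10791 before typing; a feeder for the S4 rows `q ≥ 10`, owner p9)

`card_spanF_ge_mul_card_indep`: `B` of rank `q`, `I ⊆ B` a basis of `B`, `X = B ∖ I`; for every `j₀`,
`j₀ · #{T ⊆ X : |T| = j₀, T independent} ≤ #spanF(B)` — an independent `T` extends to a basis `T ∪ I′` of `I ∪ T`
with `I′ ⊆ I` and `|I ∖ I′| = j₀`; for each `v ∈ I ∖ I′` the set `T ∪ I′ ∪ {v}` is a spanning `(q+1)`-subset of `B`,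
and `(T, v) ↦ T ∪ I′ ∪ {v}` is injective (`T = D ∖ I`, `v` the element of `D ∩ I` outside the chosen `I′`).
With the count of the independent `j₀`-subsets under the flat bound `|X| + 1 ≤ 2^{r(X)}`
(S2IndepCount: `card_filter_indep_powersetCard_ge`) the multiplicity of a rank-`q` set of nullity `ν` is
`≥ j₀·(C(ν, j₀) − (2^{j₀−1} − j₀)·C(ν, j₀ − 1))` for every `j₀` — polynomial of any fixed degree. Axioms: standard.
-/

open scoped Matroid

namespace PercRepro

namespace S2

open Set

variable {α : Type} {M : Matroid α}

open scoped Classical in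
/-- **THEOREM M**: `j₀` spanning `(q+1)`-subsets per independent `j₀`-subset of the extras. -/
theorem card_spanF_ge_mul_card_indep [M.Finite] (q : ℕ) {B I : Finset α} (hBE : (B : Set α) ⊆ M.E)
    (hBq : M.eRk (B : Set α) = (q : ℕ∞)) (hI : M.IsBasis (I : Set α) (B : Set α)) (j₀ : ℕ) :
    j₀ * (((B \ I).powersetCard j₀).filter (fun T : Finset α => M.Indep (T : Set α))).card ≤
      (spanF M q B).card := by
  have hIB : I ⊆ B := by exact_mod_cast hI.subset
  have hIE : (I : Set α) ⊆ M.E := (Finset.coe_subset.2 hIB).trans hBE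
  have hIind : M.Indep (I : Set α) := hI.indep
  have hBcl : (B : Set α) ⊆ M.closure (I : Set α) := hI.subset_closure
  have hIcard : I.card = q := by
    have h := hI.encard_eq_eRk
    rw [hBq, Set.encard_coe_eq_coe_finsetCard] at h
    exact_mod_cast h
  set X : Finset α := B \ I with hXdef
  have hXI : ∀ x ∈ X, x ∉ I := fun x hx => (Finset.mem_sdiff.1 hx).2
  have hXB : ∀ x ∈ X, x ∈ B := fun x hx => (Finset.mem_sdiff.1 hx).1
  set Ts : Finset (Finset α) := (X.powersetCard j₀).filter (fun T : Finset α => M.Indep (T : Set α)) with hTs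
  have hTsdata : ∀ T ∈ Ts, T ⊆ X ∧ T.card = j₀ ∧ M.Indep (T : Set α) := by
    intro T hT
    rw [hTs, Finset.mem_filter, Finset.mem_powersetCard] at hT
    exact ⟨hT.1.1, hT.1.2, hT.2⟩
  -- the chosen basis `J T` of `I ∪ T` containing `T`
  have hJex : ∀ T : Finset α, M.Indep (T : Set α) → (T : Set α) ⊆ M.E →
      ∃ J : Set α, M.IsBasis J ((I : Set α) ∪ T) ∧ (T : Set α) ⊆ J := by
    intro T hT hTE
    exact hT.subset_isBasis_of_subset (Set.subset_union_right) (Set.union_subset hIE hTE)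
  set J : Finset α → Set α := fun T =>
    if h : M.Indep (T : Set α) ∧ (T : Set α) ⊆ M.E then Classical.choose (hJex T h.1 h.2) else ∅ with hJdef
  have hJspec : ∀ T ∈ Ts, M.IsBasis (J T) ((I : Set α) ∪ T) ∧ (T : Set α) ⊆ J T := by
    intro T hT
    obtain ⟨hTX, -, hTind⟩ := hTsdata T hT
    have hTE : (T : Set α) ⊆ M.E := fun x hx => hBE (by exact_mod_cast hXB x (hTX (by exact_mod_cast hx)))
    have h : M.Indep (T : Set α) ∧ (T : Set α) ⊆ M.E := ⟨hTind, hTE⟩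
    simp only [hJdef, dif_pos h]
    exact Classical.choose_spec (hJex T h.1 h.2)
  -- `I′ T = I ∩ J T`
  set I' : Finset α → Finset α := fun T => I.filter (fun x => x ∈ J T) with hI'def
  have hI'I : ∀ T, I' T ⊆ I := fun T => Finset.filter_subset _ _
  have hJeq : ∀ T ∈ Ts, J T = ((I' T : Finset α) : Set α) ∪ (T : Set α) := by
    intro T hT
    obtain ⟨hJb, hTJ⟩ := hJspec T hT
    ext x
    simp only [hI'def, Finset.coe_filter, Set.mem_union, Set.mem_setOf_eq]
    constructor
    · intro hx
      rcases hJb.subset hx with hxI | hxT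
      · exact Or.inl ⟨hxI, hx⟩
      · exact Or.inr hxT
    · rintro (⟨-, hx⟩ | hx)
      · exact hx
      · exact hTJ hx
  have hI'card : ∀ T ∈ Ts, (I' T).card + j₀ = q := by
    intro T hT
    obtain ⟨hTX, hTcard, -⟩ := hTsdata T hT
    obtain ⟨hJb, -⟩ := hJspec T hT
    have hdisj : Disjoint ((I' T : Finset α) : Set α) (T : Set α) := by
      rw [Set.disjoint_left]
      intro x hx hxT
      exact hXI x (hTX (by exact_mod_cast hxT)) (by exact_mod_cast hI'I T hx)
    have hJcard : (J T).encard = (q : ℕ∞) := by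
      rw [hJb.encard_eq_eRk]
      have hcl : (I : Set α) ∪ (T : Set α) ⊆ M.closure (I : Set α) :=
        Set.union_subset (M.subset_closure _ hIE)
          (fun x hx => hBcl (by exact_mod_cast hXB x (hTX (by exact_mod_cast hx))))
      have h2 := eRk_le_card_of_subset_closure hIind hcl
      have h3 : M.eRk (I : Set α) ≤ M.eRk ((I : Set α) ∪ T) := M.eRk_mono Set.subset_union_left
      rw [hIind.eRk_eq_encard, Set.encard_coe_eq_coe_finsetCard] at h3
      rw [hIcard] at h2 h3
      exact le_antisymm h2 h3
    have h1 := hJcard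
    rw [hJeq T hT, Set.encard_union_eq hdisj, Set.encard_coe_eq_coe_finsetCard,
      Set.encard_coe_eq_coe_finsetCard, hTcard] at h1
    exact_mod_cast h1
  -- the index family and the map `(T, v) ↦ I′ T ∪ T ∪ {v}`
  set S : Finset (Σ _ : Finset α, α) := Ts.sigma (fun T => I \ I' T) with hS
  set gmap : (Σ _ : Finset α, α) → Set α :=
    fun s => (((I' s.1 ∪ s.1) ∪ {s.2} : Finset α) : Set α) with hgmap
  have hSdata : ∀ s ∈ S, s.1 ∈ Ts ∧ s.2 ∈ I ∧ s.2 ∉ I' s.1 := by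
    intro s hs
    rw [hS, Finset.mem_sigma, Finset.mem_sdiff] at hs
    exact ⟨hs.1, hs.2.1, hs.2.2⟩
  have hvT : ∀ s ∈ S, s.2 ∉ s.1 := by
    intro s hs
    obtain ⟨hT, hvI, -⟩ := hSdata s hs
    intro hv
    exact hXI _ ((hTsdata _ hT).1 hv) hvI
  have hvJ : ∀ s ∈ S, s.2 ∉ J s.1 := by
    intro s hs
    obtain ⟨hT, hvI, hvI'⟩ := hSdata s hs
    intro hv
    apply hvI'
    rw [hI'def, Finset.mem_filter]
    exact ⟨hvI, hv⟩
  -- (1) every indexed set is a spanning `(q+1)`-subset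
  have hsub : S.image gmap ⊆ spanF M q B := by
    intro D hD
    rw [Finset.mem_image] at hD
    obtain ⟨s, hs, rfl⟩ := hD
    obtain ⟨hT, hvI, hvI'⟩ := hSdata s hs
    obtain ⟨hTX, hTcard, -⟩ := hTsdata _ hT
    obtain ⟨hJb, -⟩ := hJspec _ hT
    have hD'B : (I' s.1 ∪ s.1) ∪ {s.2} ⊆ B := by
      refine Finset.union_subset (Finset.union_subset ((hI'I _).trans hIB) ?_)
        (Finset.singleton_subset_iff.2 (hIB hvI))
      intro x hx
      exact hXB x (hTX hx)
    have hJsub : J s.1 ⊆ (((I' s.1 ∪ s.1) ∪ {s.2} : Finset α) : Set α) := by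
      rw [hJeq _ hT]
      push_cast
      exact Set.subset_union_left
    have hcl : (B : Set α) ⊆ M.closure (((I' s.1 ∪ s.1) ∪ {s.2} : Finset α) : Set α) := by
      refine hBcl.trans ?_
      calc M.closure (I : Set α) ⊆ M.closure ((I : Set α) ∪ (s.1 : Set α)) :=
            M.closure_subset_closure Set.subset_union_left
        _ = M.closure (J s.1) := hJb.closure_eq_closure.symm
        _ ⊆ M.closure (((I' s.1 ∪ s.1) ∪ {s.2} : Finset α) : Set α) := M.closure_subset_closure hJsub
    rw [mem_spanF]
    refine ⟨(I' s.1 ∪ s.1) ∪ {s.2}, hD'B, ?_, ?_, hcl, rfl⟩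
    · have hd1 : Disjoint (I' s.1) s.1 := by
        rw [Finset.disjoint_left]
        intro x hx hx'
        exact hXI x (hTX hx') (hI'I _ hx)
      have hd2 : Disjoint (I' s.1 ∪ s.1) {s.2} := by
        rw [Finset.disjoint_singleton_right, Finset.mem_union, not_or]
        exact ⟨hvI', hvT s hs⟩
      rw [Finset.card_union_of_disjoint hd2, Finset.card_union_of_disjoint hd1, Finset.card_singleton, hTcard]
      have := hI'card _ hT
      omega
    · exact eRk_eq_of_subset_of_subset_closure (by exact_mod_cast hD'B) hBq hcl
  -- (2) the indexing is injective
  have hinj : Set.InjOn gmap (S : Set (Σ _ : Finset α, α)) := by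
    intro s hs s' hs' h
    have hs₁ := hSdata s (Finset.mem_coe.1 hs)
    have hs₁' := hSdata s' (Finset.mem_coe.1 hs')
    have hTX := (hTsdata _ hs₁.1).1
    have hTX' := (hTsdata _ hs₁'.1).1
    have h' : ((I' s.1 ∪ s.1) ∪ {s.2} : Finset α) = (I' s'.1 ∪ s'.1) ∪ {s'.2} := Finset.coe_inj.1 h
    -- `T = D ∖ I`
    have hT : s.1 = s'.1 := by
      have e1 : ((I' s.1 ∪ s.1) ∪ {s.2} : Finset α) \ I = s.1 := by
        ext x
        simp only [Finset.mem_sdiff, Finset.mem_union, Finset.mem_singleton]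
        constructor
        · rintro ⟨(hx | hx) | hx, hxI⟩
          · exact absurd (hI'I _ hx) hxI
          · exact hx
          · exact absurd (hx ▸ hs₁.2.1) hxI
        · intro hx
          exact ⟨Or.inl (Or.inr hx), hXI x (hTX hx)⟩
      have e2 : ((I' s'.1 ∪ s'.1) ∪ {s'.2} : Finset α) \ I = s'.1 := by
        ext x
        simp only [Finset.mem_sdiff, Finset.mem_union, Finset.mem_singleton]
        constructor
        · rintro ⟨(hx | hx) | hx, hxI⟩
          · exact absurd (hI'I _ hx) hxI
          · exact hx
          · exact absurd (hx ▸ hs₁'.2.1) hxI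
        · intro hx
          exact ⟨Or.inl (Or.inr hx), hXI x (hTX' hx)⟩
      rw [← e1, h', e2]
    -- `v` is the element of `D` outside `I′ T ∪ T`
    have hv : s.2 = s'.2 := by
      have hmem : s.2 ∈ ((I' s'.1 ∪ s'.1) ∪ {s'.2} : Finset α) := by
        rw [← h']
        exact Finset.mem_union_right _ (Finset.mem_singleton_self _)
      rw [Finset.mem_union, Finset.mem_union, Finset.mem_singleton] at hmem
      rcases hmem with (hx | hx) | hx
      · exact absurd (hT ▸ hx) hs₁.2.2
      · exact absurd (hT ▸ hx) (hvT s (Finset.mem_coe.1 hs))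
      · exact hx
    exact Sigma.ext hT (heq_of_eq hv)
  have hcardS : S.card ≤ (spanF M q B).card := by
    calc S.card = (S.image gmap).card := (Finset.card_image_of_injOn hinj).symm
      _ ≤ (spanF M q B).card := Finset.card_le_card hsub
  -- (3) the count of the index family: `j₀` per `T`
  have hcount : j₀ * Ts.card ≤ S.card := by
    rw [hS, Finset.card_sigma]
    have h : ∀ T ∈ Ts, (I \ I' T).card = j₀ := by
      intro T hT
      rw [Finset.card_sdiff_of_subset (hI'I T), hIcard]
      have := hI'card T hT
      omega
    rw [Finset.sum_congr rfl h, Finset.sum_const, smul_eq_mul, mul_comm]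
  exact hcount.trans hcardS

end S2

end PercRepro
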